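import Mathlib
import Summits.CriticalPhenomena.CardyFormulaZ2.Theses.CardyFlipRusso
import Summits.CriticalPhenomena.CardyFormulaZ2.Theorems.CardyFlipRussoSquareFromVoronoiHubDefs
import Summits.CriticalPhenomena.CardyFormulaZ2.Theorems.CardyFlipRussoSquareFromVoronoiHubDilutionDefs
import Summits.CriticalPhenomena.CardyFormulaZ2.Theorems.CardyFlipRussoSquareFromVoronoiHubDilutionHypothesisEnd
import Summits.CriticalPhenomena.CardyFormulaZ2.Theorems.CardyFlipRussoSquareFromVoronoiHubDilutionLatticeLaw
import Summits.CriticalPhenomena.CardyFormulaZ2.Theorems.CardyFlipRussoSquareFromVoronoiHubDilutionLatticeDictionary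
import Summits.CriticalPhenomena.CardyFormulaZ2.Theorems.CardyFlipRussoSquareFromVoronoiHubDilutionLatticeChain
import Summits.CriticalPhenomena.CardyFormulaZ2.Theorems.CardyFlipRussoSquareFromVoronoiHubDilutionGsConfigLaw
import Summits.CriticalPhenomena.CardyFormulaZ2.Theorems.CardyFlipRussoSquareFromVoronoiHubDilutionLatticeNoTouch
import Summits.CriticalPhenomena.CardyFormulaZ2.Theorems.CardyFlipRussoSquareFromVoronoiHubDilutionLatticeEndPart1
import Summits.CriticalPhenomena.CardyFormulaZ2.Theorems.CardyFlipRussoSquareFromVoronoiHubDilutionLatticeEnd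
import Summits.CriticalPhenomena.CardyFormulaZ2.Theorems.CardyFlipRussoSquareFromVoronoiHubDilutionEndpoint
import Literature.Probability.Percolation.VoronoiCrossing
import Literature.Analysis.FunctionSpaces.PoissonPointProcess
import HarnessLib

/-!
# SKELETON v3 of the line `poisson-dilution-leg` for crux `SquareFromVoronoiHub`
# (stmt-CriticalPhenomena-6434, route `CardyFlipRusso`, sub-problem `CardyFormulaZ2`; lead c6, 2026-08-17)

Lead c6's reshaping of lead c5's skeleton v2 (same leg — interpolate the NUCLEUS SET: `ℤ²` sites present with
probability `1 - t`, fairly coloured, superposed with black and white Poisson processes of intensity `t · volume`, fair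
hub coins at the Voronoi vertices of valency `≥ 4`).  v2 closed the crux modulo ONE stub, the UNIFORM leg constancy
`stub_dilutionLegConstancy` (all `t, t' ∈ [0,1]`); its glue consumed that stub only at `(t, t') = (1, 0)`.  v3 registers
the MINIMAL residual instead — the ENDPOINT COMPARISON `stub_dilutionEndpointComparison` (`|legProb 1 − legProb 0| ≤ ε`
eventually as `δ → 0⁺`, over the admissible Poisson pairs at each end) — and keeps the uniform leg constancy as a PROVED
sufficient condition (`endpointComparison_of_legConstancy`, landed in `…DilutionEndpoint`), next to the proved converse
`endpointComparison_of_hasCrossingLimit` (common crossing limits at both ends ⟹ endpoint comparison, by Rényi–Kingman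
uniqueness): given the two landed ends, the registered residual is exactly the crux's own `ε–δ` content, no more.

Landed pieces (all `--supports stmt-6434`, standard axioms):
* definitions + glue: `…DilutionDefs` (p156827: leg and lattice-end vocabulary, `dilutionLeg_transfer`,
  `squareFromVoronoiHub_of_dilutionLeg`, glue `stub_dilutionGlue`); `…DilutionEndpoint` (lead c6: `dilutionEndpoint_transfer`,
  `squareFromVoronoiHub_of_dilutionEndpoint`, registered glue `stub_dilutionEndpointGlue`, `endpointComparison_of_legConstancy`,
  `endpointComparison_of_hasCrossingLimit`);
* HYPOTHESIS END `stub_dilutionHypothesisEnd` (p157901): at `t = 1` the lattice is a.s. empty and hubs a.s. absent, so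
  `legProb 1 = voronoiCrossingProb`;
* LATTICE END, six landed pieces: `stub_latticeLaw` (p157907), `stub_latticeDictionary` (p157984), `stub_latticeChain`
  (p158176), `stub_gsConfigLaw` (p157967), `stub_latticeNoTouch` (p157945), `stub_latticeEnd_of` (p157964 + p158236),
  assembled as `latticeEnd_holds` (also in `…DilutionAssembly`, p158748);
* OPEN here: ONLY `stub_dilutionEndpointComparison` — the crux's `ε–δ` content between the two ends of the leg; its
  intended proof is the uniform leg constancy (crossing universality along the Poisson-dilution leg: two-term
  Russo–Mecke derivative + uniform RSW by positive association + the selection-rule RATE = kernel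
  stmt-CriticalPhenomena-7029), which nobody in the tree claims.

So the crux is KERNEL-CHECKED ⟸ `stub_dilutionEndpointComparison`: `SquareFromVoronoiHub_of` below, one `sorry`.
-/

noncomputable section

open scoped Topology
open MeasureTheory Metric Set Filter
open Literature.Analysis.FunctionSpaces (PointConfig IsPoissonPointProcess
  existsUnique_isPoissonPointProcess_holds)
open Literature.Probability.Percolation (SiteConfig sitePercolation half blackRegion voronoiCrossing)
open Literature.Probability.RandomPlanarGeometry (ConformalRectangle cardyFunction crossRatio)
open Summit.CriticalPhenomena.CardyFormulaZ2.Cruxes.SquareFromVoronoiHub.VoronoiBlocks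
  (zGs Gs crudeCrossing siteCrossingProb voronoiCrossingProb squareFromVoronoiHub_iff)

namespace Summit.CriticalPhenomena.CardyFormulaZ2.Cruxes.SquareFromVoronoiHub.PoissonDilutionLeg

/-! ### The one open stub -/

/-- **Stub (conjecture-grade; the crux's own `ε–δ` content between the two ends of the leg): ENDPOINT
COMPARISON.**  The annealed crossing probabilities of the leg at `t = 1` (Poisson pair of intensity `volume`: the
crux's hypothesis model, `stub_dilutionHypothesisEnd`) and at `t = 0` (Poisson pair of intensity `0`: cells + hubs of
the full lattice = site percolation on `G_s`, `latticeEnd_holds`) are eventually `ε`-close as the mesh `δ → 0⁺`, for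
every conformal rectangle.  Sufficient: the uniform leg constancy of skeleton v2 (`endpointComparison_of_legConstancy`),
whose intended proof is the two-term Russo–Mecke derivative along the leg + uniform RSW (positive association, exact
self-matching) + the selection-rule RATE for the `D₄`-symmetric local operators "delete a lattice nucleus" / "rain a
fair nucleus on a unit cell" — the last input is crossing universality itself (kernel stmt-CriticalPhenomena-7029;
Bálint–Camia–Meester Conj. 1.9 instance).  Conversely implied by Cardy at both ends
(`endpointComparison_of_hasCrossingLimit`).  Nobody in the tree claims a proof. [folklore] -/
theorem stub_dilutionEndpointComparison : ∀ R : ConformalRectangle, ∀ ε > (0 : ℝ), ∀ᶠ δ in 𝓝[>] (0 : ℝ),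
    ∀ (PB PW PB' PW' : Measure (PointConfig ℂ)),
      IsPoissonPointProcess (volume : Measure ℂ) PB → IsPoissonPointProcess (volume : Measure ℂ) PW →
      IsPoissonPointProcess (0 : Measure ℂ) PB' → IsPoissonPointProcess (0 : Measure ℂ) PW' →
        |legProb 1 PB PW R δ - legProb 0 PB' PW' R δ| ≤ ε := by
  sorry

/-- **The v2 stub is sufficient**: uniform leg constancy along the whole leg (the form the intended
Russo–Mecke + mean-value argument delivers) implies the registered endpoint comparison. [folklore] -/
theorem dilutionEndpointComparison_of_legConstancy
    (hK : ∀ R : ConformalRectangle, ∀ ε > (0 : ℝ), ∀ᶠ δ in 𝓝[>] (0 : ℝ),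
      ∀ (t t' : unitInterval) (PB PW PB' PW' : Measure (PointConfig ℂ)),
        IsPoissonPointProcess (ENNReal.ofReal (t : ℝ) • (volume : Measure ℂ)) PB →
        IsPoissonPointProcess (ENNReal.ofReal (t : ℝ) • (volume : Measure ℂ)) PW →
        IsPoissonPointProcess (ENNReal.ofReal (t' : ℝ) • (volume : Measure ℂ)) PB' →
        IsPoissonPointProcess (ENNReal.ofReal (t' : ℝ) • (volume : Measure ℂ)) PW' →
          |legProb t PB PW R δ - legProb t' PB' PW' R δ| ≤ ε) :
    ∀ R : ConformalRectangle, ∀ ε > (0 : ℝ), ∀ᶠ δ in 𝓝[>] (0 : ℝ),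
      ∀ (PB PW PB' PW' : Measure (PointConfig ℂ)),
        IsPoissonPointProcess (volume : Measure ℂ) PB → IsPoissonPointProcess (volume : Measure ℂ) PW →
        IsPoissonPointProcess (0 : Measure ℂ) PB' → IsPoissonPointProcess (0 : Measure ℂ) PW' →
          |legProb 1 PB PW R δ - legProb 0 PB' PW' R δ| ≤ ε :=
  endpointComparison_of_legConstancy hK

/-! ### Composition (kernel-checked) -/

/-- **The lattice end, assembled from its landed pieces** (law reduction, dictionary, chain lemma,
`G_s` law, no-touch lemma ⇒ Cardy for `legProb 0` gives Cardy for `siteCrossingProb`). [folklore] -/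
theorem latticeEnd_holds :
    (∀ (PB PW : Measure (PointConfig ℂ)),
        IsPoissonPointProcess (0 : Measure ℂ) PB → IsPoissonPointProcess (0 : Measure ℂ) PW →
        ∀ R : ConformalRectangle, R.HasCrossingLimit (legProb 0 PB PW R) cardyFunction) →
      ∀ R : ConformalRectangle, R.HasCrossingLimit (siteCrossingProb R) cardyFunction :=
  stub_latticeEnd_of stub_latticeLaw stub_latticeDictionary stub_latticeChain stub_gsConfigLaw
    stub_latticeNoTouch

/-- **The line closes the crux modulo its one open stub**: `SquareFromVoronoiHub` BY NAME from the landed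
glue (`stub_dilutionEndpointGlue`), the landed hypothesis end, the OPEN endpoint comparison and the landed
lattice end. [folklore] -/
theorem SquareFromVoronoiHub_of :
    Summit.CriticalPhenomena.CardyFormulaZ2.Theses.CardyFlipRusso.SquareFromVoronoiHub :=
  squareFromVoronoiHub_iff.2
    (stub_dilutionEndpointGlue stub_dilutionHypothesisEnd stub_dilutionEndpointComparison latticeEnd_holds)

end Summit.CriticalPhenomena.CardyFormulaZ2.Cruxes.SquareFromVoronoiHub.PoissonDilutionLeg

end
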